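import Summits.ValiantsHypothesis.ValiantsHypothesis.Theorems.KPlusLogSqLawTridiagonalRealStaticPotentialLawRefuted

/-!
# Route «KPlusLogSqLaw», crux `WeakLifting` (stmt-ValiantsHypothesis-19561) — REAL side of the tridiagonal sector:
# the CONDITIONAL UPPER ROW RESTATED ON THE CHAIN FORM (P_Σ) of the potential law (the local form (P) being false)

HONEST FRAMING.  Helper (`--supports stmt-ValiantsHypothesis-19561 --as helper`), seat val-sym-lift-p1 (g13), cell `pub-symmetroid`,
2026-08-28.  val-sym-lift-p3 g10's conditional upper row `card_posRoots_le_of_potentialLawP : PotentialLawP → card posRoots ≤ 2m − 2` has a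
REFUTED hypothesis (`not_potentialLawP`, this seat).  Its proof, however, consumes only the CHAIN FORM of the potential law — «for every
static definite symmetric tridiagonal monomial design with nonzero links and every `k`, `Θ(rootWord D_k D_{k+1}) ≤ 2k`» (lift-p3's
`theta_rootWord_le` derived it from the local steps).  This file restates the conditional row with the chain form AS THE HYPOTHESIS (stated
inline, no definition; it is implied by the old hypothesis and is NOT refuted — located: all examined designs satisfy it with room, seat memo
P-REFUTED-liftp1g13.md §3b):
* `card_posRoots_pathDet_succ_le_of_thetaChain` — nonzero links: `card posRoots(D_{m+1}) ≤ 2m` from the chain bound at level `m` of THAT design;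
* `card_posRoots_pathDet_le_of_thetaChain` — all static DEFINITE designs of size `n` (zero links allowed, by block splitting), from the chain
  form for all designs with nonzero links at levels `< n`: `card posRoots(D_n) ≤ 2n − 2`;
* `card_posRoots_le_of_thetaChain` — the same in the typed matrix currency of the α target (`c`, `e` symmetric, `c = 0` off the band, `0 < c i i`).
So the α register's conditional upper row survives the death of (P) in the form «(P_Σ) ⇒ B m ≤ 2m − 2 (kernel)»; (P_Σ) is OPEN (located only),
and for `m ≥ 7` it is genuinely stronger than the row (root words of length ≈ 4m).  No upper law is proved; α does not move.  Nothing here bears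
on `WeakLifting` / `TropicalB` (stmt-19771) in their windows, on Conjecture B, on the Door-A registers, on `MatrixDescartes`
(stmt-ValiantsHypothesis-18050) or on VP ≠ VNP.
[val-sym-lift-p3 g10's row argument (…TridiagonalRealStaticPotentialRow), re-hypothesised; this cell's located chain form (P_Σ)]
-/

-- `Summit.ValiantsHypothesis.ValiantsHypothesis.…` repeats a component by the D-0017 layout (single-conjunct summit); the name is mandated.
set_option linter.dupNamespace false
set_option autoImplicit false

namespace Summit.ValiantsHypothesis.ValiantsHypothesis.Theorems.KPlusLogSqLaw

namespace StaticTridiagonalRealCut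

open Polynomial
open Summit.ValiantsHypothesis.ValiantsHypothesis.Theorems.KPlusLogSqLaw.StaticTridiagonalRealPotential
  (pathDet pathDet_zero pathDet_one pathDet_add_two pathDet_split pathDet_congr eval_pathDet_succ_ne_zero theta rootWord
    count_le_theta card_posRoots_le_count_true card_posRoots_mul_le det_of_eq_pathDet)

/-- **Nonzero links**: if the chain form holds at level `m` for the design — `Θ(rootWord D_m D_{m+1}) ≤ 2m` — then `D_{m+1}` has at most `2m`
distinct positive zeros (degenerate case `D_m · D_{m+1} ≡ 0`: none at all). [val-sym-lift-p3 g10's argument, re-hypothesised] -/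
theorem card_posRoots_pathDet_succ_le_of_thetaChain (a : ℕ → ℝ) (d : ℕ → ℕ) (b : ℕ → ℝ) (f : ℕ → ℕ) (m : ℕ)
    (hch : theta (rootWord (pathDet a d b f m) (pathDet a d b f (m + 1))) ≤ 2 * m)
    (ha : ∀ t, 0 < a t) (hb : ∀ t, b t ≠ 0) :
    ((pathDet a d b f (m + 1)).roots.toFinset.filter (fun x => 0 < x)).card ≤ 2 * m := by
  classical
  by_cases hprod : pathDet a d b f m * pathDet a d b f (m + 1) = 0
  · have hempty : (pathDet a d b f (m + 1)).roots.toFinset.filter (fun x => 0 < x) = ∅ := by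
      refine Finset.filter_false_of_mem fun x hx hxpos => ?_
      rw [Multiset.mem_toFinset] at hx
      have hroot := (Polynomial.mem_roots'.1 hx)
      rcases mul_eq_zero.1 hprod with hm | hm1
      · rcases m with _ | _ | m
        · simp [pathDet_zero] at hm
        · rw [pathDet_one] at hm
          exact absurd (leadingCoeff_eq_zero.2 hm) (by
            rw [leadingCoeff_mul, leadingCoeff_C, leadingCoeff_X_pow, mul_one]; exact (ha 0).ne')
        · have h2 := hroot.2
          rw [IsRoot.def, pathDet_add_two, hm] at h2
          simp only [mul_zero, zero_sub, eval_neg, neg_eq_zero, eval_mul, eval_pow, eval_C, eval_X] at h2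
          rcases mul_eq_zero.1 h2 with h | h
          · exact absurd h (pow_ne_zero _ (mul_ne_zero (hb (m + 1)) (pow_ne_zero _ hxpos.ne')))
          · exact eval_pathDet_succ_ne_zero a d b f hb hxpos (m + 1) h (by rw [hm, eval_zero])
      · exact hroot.1 hm1
    rw [hempty, Finset.card_empty]
    exact Nat.zero_le _
  · calc ((pathDet a d b f (m + 1)).roots.toFinset.filter (fun x => 0 < x)).card
        ≤ (rootWord (pathDet a d b f m) (pathDet a d b f (m + 1))).count true := card_posRoots_le_count_true hprod
      _ ≤ theta (rootWord (pathDet a d b f m) (pathDet a d b f (m + 1))) := count_le_theta _ _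
      _ ≤ 2 * m := hch

/-- **CONDITIONAL UPPER ROW ON THE CHAIN FORM, continuant currency**: if every static definite symmetric tridiagonal monomial design with
NONZERO links satisfies `Θ(rootWord D_k D_{k+1}) ≤ 2k` for all `k + 1 ≤ n`, then every static DEFINITE design of size `n` (zero links allowed)
has at most `2n − 2` distinct positive determinant zeros.  Strong induction on the size (a zero link splits the continuant). [this file] -/
theorem card_posRoots_pathDet_le_of_thetaChain :
    ∀ (n : ℕ), (∀ (a : ℕ → ℝ) (d : ℕ → ℕ) (b : ℕ → ℝ) (f : ℕ → ℕ), (∀ t, 0 < a t) → (∀ t, b t ≠ 0) →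
        ∀ k : ℕ, k + 1 ≤ n → theta (rootWord (pathDet a d b f k) (pathDet a d b f (k + 1))) ≤ 2 * k) →
      ∀ (a : ℕ → ℝ) (d : ℕ → ℕ) (b : ℕ → ℝ) (f : ℕ → ℕ), (∀ t, 0 < a t) →
        ((pathDet a d b f n).roots.toFinset.filter (fun x => 0 < x)).card ≤ 2 * n - 2 := by
  classical
  intro n
  induction n using Nat.strong_induction_on with
  | _ n ih =>
    intro hch a d b f ha
    rcases n with _ | m
    · simp [pathDet_zero]
    · by_cases hzero : ∃ t, t + 1 < m + 1 ∧ b t = 0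
      · obtain ⟨t, ht, hbt⟩ := hzero
        obtain ⟨n', hn'⟩ : ∃ n', m + 1 = t + 1 + n' := ⟨m - t, by omega⟩
        have h1 := ih (t + 1) (by omega) (fun a d b f ha hb k hk => hch a d b f ha hb k (by omega)) a d b f ha
        have h2 := ih n' (by omega) (fun a d b f ha hb k hk => hch a d b f ha hb k (by omega))
          (fun s => a (s + (t + 1))) (fun s => d (s + (t + 1))) (fun s => b (s + (t + 1))) (fun s => f (s + (t + 1))) (fun s => ha _)
        rw [hn', pathDet_split a d b f hbt n']
        refine (card_posRoots_mul_le _ _).trans ?_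
        omega
      · push Not at hzero
        have hb'ne : ∀ t, (if t + 1 < m + 1 then b t else (1 : ℝ)) ≠ 0 := by
          intro t
          split_ifs with h
          · exact hzero t h
          · exact one_ne_zero
        rw [pathDet_congr (a := a) (a' := a) (d := d) (d' := d) (b := b) (b' := fun t => if t + 1 < m + 1 then b t else 1)
          (f := f) (f' := f) (n := m + 1) (fun _ _ => rfl) (fun _ _ => rfl)
          (fun t ht => by rw [if_pos ht]) (fun _ _ => rfl)]
        have hchain := hch a d (fun t => if t + 1 < m + 1 then b t else 1) f ha hb'ne m le_rfl
        have hc : pathDet a d (fun t => if t + 1 < m + 1 then b t else 1) f m = pathDet a d b f m :=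
          pathDet_congr (fun _ _ => rfl) (fun _ _ => rfl) (fun t ht => by rw [if_pos (by omega)]) (fun _ _ => rfl)
        exact (card_posRoots_pathDet_succ_le_of_thetaChain a d (fun t => if t + 1 < m + 1 then b t else 1) f m hchain ha hb'ne).trans
          (by omega)

/-- **CONDITIONAL UPPER ROW ON THE CHAIN FORM (P_Σ), matrix currency of the α target**: if every static definite symmetric tridiagonal
monomial design with nonzero links satisfies the chain form `Θ(rootWord D_k D_{k+1}) ≤ 2k` (`k + 1 ≤ m`), then every static DEFINITE symmetric
tridiagonal `m × m` monomial matrix (`c`, `e` symmetric, `c = 0` off the band, `0 < c i i`) has at most `2m − 2` distinct positive determinant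
zeros.  The hypothesis replaces the refuted (P); it is OPEN (located on all examined designs). [this file] -/
theorem card_posRoots_le_of_thetaChain (m : ℕ)
    (hch : ∀ (a : ℕ → ℝ) (d : ℕ → ℕ) (b : ℕ → ℝ) (f : ℕ → ℕ), (∀ t, 0 < a t) → (∀ t, b t ≠ 0) →
      ∀ k : ℕ, k + 1 ≤ m → theta (rootWord (pathDet a d b f k) (pathDet a d b f (k + 1))) ≤ 2 * k)
    (c : Fin m → Fin m → ℝ) (e : Fin m → Fin m → ℕ) (hc : ∀ i j, c i j = c j i) (he : ∀ i j, e i j = e j i)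
    (hband : ∀ i j : Fin m, (i : ℕ) + 1 < j ∨ (j : ℕ) + 1 < i → c i j = 0) (hpos : ∀ i, 0 < c i i) :
    ((Matrix.det (Matrix.of fun i j => C (c i j) * (X : ℝ[X]) ^ e i j)).roots.toFinset.filter
      (fun t : ℝ => 0 < t)).card ≤ 2 * m - 2 := by
  rw [det_of_eq_pathDet c e hc he hband]
  refine card_posRoots_pathDet_le_of_thetaChain m hch _ _ _ _ fun t => ?_
  by_cases h : t < m
  · rw [dif_pos h]; exact hpos _
  · rw [dif_neg h]; exact one_pos

end StaticTridiagonalRealCut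

end Summit.ValiantsHypothesis.ValiantsHypothesis.Theorems.KPlusLogSqLaw
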